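import Mathlib
import Literature.NumberTheory.Transcendental.GammaFields
import Literature.NumberTheory.Transcendental.ZilberField
import Summits.Schanuel.Schanuel.Theorems.RigidCoreAclSubsetLogFreeCoreCaseIIShiftAut
import Summits.Schanuel.Schanuel.Theorems.RigidCoreAclSubsetLogFreeCoreCaseIIReduceAssembly

/-!
# Case II reduction: the registered stub `stub_caseII_reduce`
(line `eac-extends-core-automorphisms`, crux stmt-Schanuel-0968
`Summit.Schanuel.Schanuel.Theses.RigidCore.AclSubsetLogFreeCore`)

The registered stub `stub_caseII_reduce` assembled from
* `caseII_reduce_of_shiftAut` (file `…CaseIIReduceAssembly`): the reduction of Case II to the core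
  claim, granted the branch-shifting automorphisms of L-steps, and
* `stub_caseII_shiftAut` (file `…CaseIIShiftAut`): the branch-shifting automorphisms in a Zilber field
  equal to its own `ecl ∅`.
-/

noncomputable section

set_option linter.dupNamespace false

open Set
open Literature.ModelTheory.ExponentialFields Literature.ModelTheory.ExponentialFields.ExponentialRing
open Literature.NumberTheory.Transcendental Literature.NumberTheory.Transcendental.GammaField

namespace Summit.Schanuel.Schanuel.Theorems.RigidCore

/-- **Stub 7b — Case II, reduction to the core claim** (registered stub `stub_caseII_reduce` of crux
stmt-Schanuel-0968). In a Zilber field `E` which is its own `ecl ∅`, with kernel `τℤ`, granted the core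
claim `hcore` (the neighbouring stub `stub_caseII_core`, verbatim), every element of the ELA-core over
`τ` (the least intermediate field `∋ τ` closed under `exp`, under logarithms and relatively
algebraically closed) fixed by every exponential field automorphism of `E` lies in the EA-core (the
same without logarithms): `caseII_reduce_of_shiftAut` with the branch shifts of `stub_caseII_shiftAut`.
[cite: BaysKirby2018ANT, Lemma 4.8, §4.4] -/
theorem stub_caseII_reduce {E : Type} [Field E] [CharZero E] [ExponentialRing E]
    (hE : IsZilberField E) (huniv : ecl (∅ : Set E) = Set.univ)
    (τ : E) (hker : expKernel E = AddSubgroup.zmultiples τ)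
    (hcore : ∀ (X : Submodule ℚ E), τ ∈ X → X.FG → IsStrong X →
      ∀ (ℓ : E), exp ℓ ∈ acl (gens X) → ℓ ∉ acl (gens X) →
      ∀ (U : Submodule ℚ E) (s : ℕ) (v : Fin s → E),
        U = (X ⊔ Submodule.span ℚ {ℓ}) ⊔ Submodule.span ℚ (range v) →
        (∀ i : Fin s,
          v i ∉ (X ⊔ Submodule.span ℚ {ℓ}) ⊔ Submodule.span ℚ (v '' Set.Iio i) ∧
          v i ∈ acl (gens ((X ⊔ Submodule.span ℚ {ℓ}) ⊔ Submodule.span ℚ (v '' Set.Iio i)))) →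
        (∀ u ∈ U, u ∈ acl (gens X) → u ∈ X) →
        ∀ (θ : E ≃+* E), (∀ x, θ (exp x) = exp (θ x)) → (∀ x ∈ X, θ x = x) →
          ∀ (q : ℚ), q ≠ 0 → θ ℓ = ℓ + q • τ → (∀ u, u ∈ U ↔ θ u ∈ U) →
            ∀ a ∈ U, θ a = a → a ∈ X) :
    ∀ a : E,
      a ∈ (sInf {K : IntermediateField ℚ E | τ ∈ K ∧ (∀ w ∈ K, exp w ∈ K) ∧
          (∀ w : E, IsAlgebraic K w → w ∈ K) ∧ (∀ w : E, exp w ∈ K → w ∈ K)} :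
            IntermediateField ℚ E) →
      (∀ θ : E ≃+* E, (∀ x, θ (exp x) = exp (θ x)) → θ a = a) →
        a ∈ (sInf {K : IntermediateField ℚ E | τ ∈ K ∧ (∀ w ∈ K, exp w ∈ K) ∧
          (∀ w : E, IsAlgebraic K w → w ∈ K)} : IntermediateField ℚ E) :=
  caseII_reduce_of_shiftAut hE huniv τ hker
    (fun {_} c hXs {_} hℓexp hℓ => stub_caseII_shiftAut hE huniv hker c hXs hℓexp hℓ) hcore

end Summit.Schanuel.Schanuel.Theorems.RigidCore
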